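import Mathlib
import HarnessLib
import Literature.Probability.Percolation.MinOpenCut
import Literature.Probability.Percolation.MinOpenCutMenger
import Summits.CriticalPhenomena.PercolationContinuityZ3.Theses.PercBudgetLadder
import Summits.CriticalPhenomena.PercolationContinuityZ3.Theses.PercNonProliferation
import Summits.CriticalPhenomena.PercolationContinuityZ3.Theorems.PercBudgetLadderBudgetTightnessDictionary
import Summits.CriticalPhenomena.PercolationContinuityZ3.Theorems.PercNonProliferationNonProliferationOfBudgetTightnessTwo

/-!
# Aspect-2 normal forms of crux `BudgetTightness` (stmt-CriticalPhenomena-5248) and the cross-route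
# corollary `BudgetTightness → PercNonProliferation.NonProliferation`

Helper file (`--supports stmt-CriticalPhenomena-5248`, line `Sketch`, lead cycle 2). The dictionary
`Theorems/PercBudgetLadderBudgetTightnessDictionary.lean` shows `BudgetTightness ⟺ SlabCutQuadraticIO(p_c)`;
composing its (⇒) half with the six-lid inequality (`stub_sixLids`, which lands at ASPECT 2) and Markov's
inequality AT A FIXED ASPECT gives the normal forms below. Notation of the docstrings: `P = P_{p_c(ℤ³)}`,
`MinCut(n, l n) = minOpenCutIn ↑(box 3 (l n)) ↑(box 3 n) ↑(innerBoundary (zdGraph 3) (box 3 (l n)))`,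
`S(L,h)` = bottom-to-top min-cut of the slab piece `[0,L]²×[0,h]`, `E[X] = ∫ (X ω).toNat ∂P`.

* `budgetTightness_iff_meanCutBoundedIO_two` : `BudgetTightness ⟺ ∃ C, ∀ N, ∃ n ≥ N, E[MinCut(n,2n)] ≤ C`
  — any aspect `l ≥ 2` in the crux can be traded for the HARDEST aspect `l = 2` (a thicker annulus is
  easier to block), through the slab core: patch cutsets up, six lids down.
* `budgetTightness_iff_tight_two` : `BudgetTightness ⟺ ∀ c < 1, ∃ k, for infinitely many n,
  P(MinCut(n,2n) ≤ k) ≥ c` — the crux's `∃ c > 0` SELF-IMPROVES to every `c < 1` (genuine tightness of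
  the law of `MinCut(n,2n)` along a subsequence), by Markov on the bounded first moment.
* `budgetTightness_iff_aspect_two` : `BudgetTightness ⟺` its own `l = 2` slice
  `∃ k c, 0 < c ∧ ∀ N, ∃ n ≥ N, c ≤ P(budget-k event of B(n) → ∂ⁱⁿB(2n))`.
* `nonProliferation_of_budgetTightness` : the crux r2 of route `PercBudgetLadder` implies the crux
  `NonProliferation` of route `PercNonProliferation` (stmt-CriticalPhenomena-4444: tight number of
  annulus-spanning clusters at aspect 2, i.o.) — previously recorded only for the `l = 2` slice
  (`NonProliferation.nonProliferation_of_budgetTightness_two`); the slice restriction is now removed.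
-/

noncomputable section

namespace Summit.CriticalPhenomena.PercolationContinuityZ3.Theorems.BudgetTightness

open MeasureTheory Filter Topology
open Literature.Probability.Percolation Literature.Probability.LatticeModels
open Summit.CriticalPhenomena.PercolationContinuityZ3.Theses.PercBudgetLadder (BudgetTightness)

namespace AspectTwo

/-- **Slab core ⇒ bounded mean AT ASPECT 2** (six lids, `L = 4h+4`): along the core's good `h ≥ 1`,
`E[MinCut(h+1, 2(h+1))] ≤ 384 · max C 0`. (The dictionary's `budgetTightness_of_slabCutQuadraticIO`
passes through `stub_markov`, whose conclusion hides the aspect behind `∃ l`; here it is kept.) -/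
theorem meanCutBoundedIO_two_of_slabCutQuadraticIO
    (hC : ∃ C : ℝ, ∀ H : ℕ, ∃ h : ℕ, H ≤ h ∧ ∀ L : ℕ, h ≤ L →
      (h : ℝ) ^ 2 * ∫ ω, ((minOpenCutIn
          (Set.Icc (![0, 0, 0] : Site 3) ![(L : ℤ), (L : ℤ), (h : ℤ)])
          (Set.Icc (![0, 0, 0] : Site 3) ![(L : ℤ), (L : ℤ), 0])
          (Set.Icc (![0, 0, (h : ℤ)] : Site 3) ![(L : ℤ), (L : ℤ), (h : ℤ)])
          ω).toNat : ℝ) ∂(bondPercolation (zdGraph 3) (criticalProbI 3)) ≤ C * (L : ℝ) ^ 2) :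
    ∃ C : ℝ, ∀ N : ℕ, ∃ n : ℕ, N ≤ n ∧
      ∫ ω, ((minOpenCutIn (↑(box 3 (2 * n)) : Set (Site 3)) (↑(box 3 n) : Set (Site 3))
        (↑(innerBoundary (zdGraph 3) (box 3 (2 * n))) : Set (Site 3)) ω).toNat : ℝ)
        ∂(bondPercolation (zdGraph 3) (criticalProbI 3)) ≤ C := by
  obtain ⟨C, hcore⟩ := hC
  refine ⟨384 * max C 0, fun N => ?_⟩
  obtain ⟨h, hHh, hL⟩ := hcore (max N 1)
  have hh1 : 1 ≤ h := le_trans (le_max_right _ _) hHh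
  have hI := Dictionary.integral_le_of_sq_mul_le hh1 (hL (4 * h + 4) (by omega))
  refine ⟨h + 1, by omega, ?_⟩
  calc ∫ ω, ((minOpenCutIn (↑(box 3 (2 * (h + 1))) : Set (Site 3)) (↑(box 3 (h + 1)) : Set (Site 3))
          (↑(innerBoundary (zdGraph 3) (box 3 (2 * (h + 1)))) : Set (Site 3)) ω).toNat : ℝ)
          ∂(bondPercolation (zdGraph 3) (criticalProbI 3))
      ≤ 6 * (64 * max C 0) := (stub_sixLids (criticalProbI 3) h hh1).trans (by gcongr)
    _ = 384 * max C 0 := by ring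

/-- For `1 ≤ n`, `2 ≤ l` the annulus budget `MinCut(n, l n)` is finite (source and sink are disjoint). -/
theorem annulusBudget_ne_top {n l : ℕ} (hn : 1 ≤ n) (hl : 2 ≤ l) (ω : BondConfig (Site 3)) :
    minOpenCutIn (↑(box 3 (l * n)) : Set (Site 3)) (↑(box 3 n) : Set (Site 3))
      (↑(innerBoundary (zdGraph 3) (box 3 (l * n))) : Set (Site 3)) ω ≠ ⊤ := by
  rw [Ne, minOpenCutIn_eq_top_iff_of_finite (Finset.finite_toSet _)]
  rintro ⟨a, -, ha, hb⟩
  exact StubBkTail.not_mem_innerBoundary_of_mem_box hn hl ha hb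

/-- **Markov at a FIXED aspect, every level `c < 1`**: a bound `E[MinCut(n, l n)] ≤ C` along a
subsequence gives, for every `c < 1`, a budget `k` (any `k + 1 ≥ max(C,0)/(1-c)`) with
`P(MinCut(n, l n) ≤ k) ≥ c` along the SAME subsequence — the aspect `l` is kept. -/
theorem budget_io_of_meanCutBoundedIO_at {l : ℕ} (hl : 2 ≤ l) {C : ℝ}
    (hC : ∀ N : ℕ, ∃ n : ℕ, N ≤ n ∧
      ∫ ω, ((minOpenCutIn (↑(box 3 (l * n)) : Set (Site 3)) (↑(box 3 n) : Set (Site 3))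
        (↑(innerBoundary (zdGraph 3) (box 3 (l * n))) : Set (Site 3)) ω).toNat : ℝ)
        ∂(bondPercolation (zdGraph 3) (criticalProbI 3)) ≤ C)
    {c : ℝ} (hc : c < 1) :
    ∃ k : ℕ, ∀ N : ℕ, ∃ n : ℕ, N ≤ n ∧
      c ≤ (bondPercolation (zdGraph 3) (criticalProbI 3)).real
        {ω | minOpenCutIn (↑(box 3 (l * n)) : Set (Site 3)) (↑(box 3 n) : Set (Site 3))
          (↑(innerBoundary (zdGraph 3) (box 3 (l * n))) : Set (Site 3)) ω ≤ k} := by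
  have h1c : 0 < 1 - c := by linarith
  obtain ⟨k, hk⟩ := exists_nat_ge (max C 0 / (1 - c))
  refine ⟨k, fun N => ?_⟩
  obtain ⟨n, hn, hb⟩ := hC (max N 1)
  have hn1 : 1 ≤ n := le_trans (le_max_right _ _) hn
  refine ⟨n, le_trans (le_max_left _ _) hn, ?_⟩
  set μ := bondPercolation (zdGraph 3) (criticalProbI 3) with hμ
  set f : BondConfig (Site 3) → ℝ := fun ω => ((minOpenCutIn (↑(box 3 (l * n)) : Set (Site 3))
      (↑(box 3 n) : Set (Site 3)) (↑(innerBoundary (zdGraph 3) (box 3 (l * n))) : Set (Site 3))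
      ω).toNat : ℝ) with hf
  have hint : Integrable f μ :=
    StubSixLids.integrable_toNat_minOpenCutIn (Finset.finite_toSet _) _ _ _ _
  have hcompl : {ω | minOpenCutIn (↑(box 3 (l * n)) : Set (Site 3)) (↑(box 3 n) : Set (Site 3))
        (↑(innerBoundary (zdGraph 3) (box 3 (l * n))) : Set (Site 3)) ω ≤ k}ᶜ ⊆
      {ω | ((k : ℝ) + 1) ≤ f ω} := by
    intro ω hω
    simp only [Set.mem_compl_iff, Set.mem_setOf_eq, not_le] at hω
    simp only [Set.mem_setOf_eq, hf]
    have h1 : ((k + 1 : ℕ) : ℕ∞) ≤ minOpenCutIn (↑(box 3 (l * n)) : Set (Site 3))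
        (↑(box 3 n) : Set (Site 3)) (↑(innerBoundary (zdGraph 3) (box 3 (l * n))) : Set (Site 3)) ω := by
      have := Order.add_one_le_of_lt hω
      exact_mod_cast this
    have h2 := ENat.toNat_le_toNat h1 (annulusBudget_ne_top hn1 hl ω)
    rw [ENat.toNat_coe] at h2
    exact_mod_cast h2
  have hmeas : MeasurableSet {ω | minOpenCutIn (↑(box 3 (l * n)) : Set (Site 3))
      (↑(box 3 n) : Set (Site 3)) (↑(innerBoundary (zdGraph 3) (box 3 (l * n))) : Set (Site 3)) ω ≤ k} :=
    measurableSet_setOf_minOpenCutIn_le (Finset.finite_toSet _) _ _ k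
  have hnonneg : 0 ≤ᵐ[μ] f := Filter.Eventually.of_forall fun ω => by simp [hf]
  have hmarkov : ((k : ℝ) + 1) * μ.real {ω | ((k : ℝ) + 1) ≤ f ω} ≤ ∫ ω, f ω ∂μ :=
    mul_meas_ge_le_integral_of_nonneg hnonneg hint _
  have hkpos : (0 : ℝ) < (k : ℝ) + 1 := by positivity
  have hI : ∫ ω, f ω ∂μ ≤ max C 0 := hb.trans (le_max_left _ _)
  -- `max C 0 ≤ (1 - c) (k + 1)`
  have hkC : max C 0 ≤ (1 - c) * ((k : ℝ) + 1) := by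
    rw [div_le_iff₀ h1c] at hk
    nlinarith [le_max_right C 0]
  have htail : μ.real {ω | ((k : ℝ) + 1) ≤ f ω} ≤ 1 - c := by
    by_contra hlt
    push Not at hlt
    have : (1 - c) * ((k : ℝ) + 1) < ((k : ℝ) + 1) * μ.real {ω | ((k : ℝ) + 1) ≤ f ω} := by
      nlinarith
    linarith
  have hprob : μ.real {ω | minOpenCutIn (↑(box 3 (l * n)) : Set (Site 3))
      (↑(box 3 n) : Set (Site 3)) (↑(innerBoundary (zdGraph 3) (box 3 (l * n))) : Set (Site 3)) ω ≤ k} =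
      1 - μ.real {ω | minOpenCutIn (↑(box 3 (l * n)) : Set (Site 3))
      (↑(box 3 n) : Set (Site 3)) (↑(innerBoundary (zdGraph 3) (box 3 (l * n))) : Set (Site 3)) ω ≤ k}ᶜ := by
    rw [measureReal_compl hmeas, probReal_univ]; ring
  have hmono : μ.real {ω | minOpenCutIn (↑(box 3 (l * n)) : Set (Site 3))
      (↑(box 3 n) : Set (Site 3)) (↑(innerBoundary (zdGraph 3) (box 3 (l * n))) : Set (Site 3)) ω ≤ k}ᶜ ≤
      μ.real {ω | ((k : ℝ) + 1) ≤ f ω} := measureReal_mono hcompl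
  rw [hprob]
  linarith

/-- The route's budget event at `(n, l, k)` is `{MinCut(n, l n) ≤ k}` (`minOpenCutIn_le_iff`). -/
theorem budgetEvent_eq (n l k : ℕ) :
    {ω : BondConfig (Site 3) | ∃ S : Finset (Sym2 (Site 3)), S.card ≤ k ∧
      ¬ ∃ x ∈ box 3 n, ∃ y ∈ innerBoundary (zdGraph 3) (box 3 (l * n)),
        (ω \ ↑S) ∈ openConnIn (↑(box 3 (l * n)) : Set (Site 3)) x y} =
      {ω | minOpenCutIn (↑(box 3 (l * n)) : Set (Site 3)) (↑(box 3 n) : Set (Site 3))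
          (↑(innerBoundary (zdGraph 3) (box 3 (l * n))) : Set (Site 3)) ω ≤ k} := by
  ext ω
  simp only [Set.mem_setOf_eq, minOpenCutIn_le_iff, Finset.mem_coe]

end AspectTwo

open AspectTwo

/-- **Aspect-2 normal form in expectation: `BudgetTightness ⟺ MeanCutBoundedIO(p_c)` at `l = 2`** —
the crux holds iff `E[MinCut(n, 2n)]` is bounded along a subsequence. (⇒ the dictionary's
`slabCutQuadraticIO_of_budgetTightness` followed by the six lids at aspect 2; ⇐ Markov, `stub_markov`.) -/
theorem budgetTightness_iff_meanCutBoundedIO_two :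
    BudgetTightness ↔
      ∃ C : ℝ, ∀ N : ℕ, ∃ n : ℕ, N ≤ n ∧
        ∫ ω, ((minOpenCutIn (↑(box 3 (2 * n)) : Set (Site 3)) (↑(box 3 n) : Set (Site 3))
          (↑(innerBoundary (zdGraph 3) (box 3 (2 * n))) : Set (Site 3)) ω).toNat : ℝ)
          ∂(bondPercolation (zdGraph 3) (criticalProbI 3)) ≤ C := by
  constructor
  · exact fun h => meanCutBoundedIO_two_of_slabCutQuadraticIO (slabCutQuadraticIO_of_budgetTightness h)
  · rintro ⟨C, hC⟩
    exact stub_markov ⟨2, C, le_rfl, hC⟩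

/-- **Self-improvement of the constant: `BudgetTightness ⟺` the law of `MinCut(n,2n)` is TIGHT along a
subsequence** — for EVERY `c < 1` there is a budget `k` such that, for infinitely many `n`, with
probability at least `c` the critical annulus `B(n) → ∂ⁱⁿB(2n)` is blocked by closing at most `k` edges.
(The crux asks this for one `c > 0` at one aspect `l ≥ 2`; Markov on the bounded first moment at aspect 2
gives it for all `c < 1`.) -/
theorem budgetTightness_iff_tight_two :
    BudgetTightness ↔
      ∀ c : ℝ, c < 1 → ∃ k : ℕ, ∀ N : ℕ, ∃ n : ℕ, N ≤ n ∧
        c ≤ (bondPercolation (zdGraph 3) (criticalProbI 3)).real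
          {ω | ∃ S : Finset (Sym2 (Site 3)), S.card ≤ k ∧
            ¬ ∃ x ∈ box 3 n, ∃ y ∈ innerBoundary (zdGraph 3) (box 3 (2 * n)),
              (ω \ ↑S) ∈ openConnIn (↑(box 3 (2 * n)) : Set (Site 3)) x y} := by
  constructor
  · intro h c hc
    obtain ⟨C, hC⟩ := budgetTightness_iff_meanCutBoundedIO_two.1 h
    obtain ⟨k, hk⟩ := budget_io_of_meanCutBoundedIO_at (l := 2) le_rfl hC hc
    refine ⟨k, fun N => ?_⟩
    obtain ⟨n, hn, hb⟩ := hk N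
    refine ⟨n, hn, ?_⟩
    rwa [budgetEvent_eq n 2 k]
  · intro h
    obtain ⟨k, hk⟩ := h (1 / 2) (by norm_num)
    exact ⟨k, 2, 1 / 2, le_rfl, by norm_num, hk⟩

/-- **Aspect-2 normal form: `BudgetTightness ⟺` its own `l = 2` slice** — the crux holds iff for some
budget `k` and some `c > 0`, for infinitely many `n`, with probability `≥ c` the critical annulus
`B(n) → ∂ⁱⁿB(2n)` can be blocked by closing at most `k` edges. Aspect `2` is the HARDEST aspect, so
this slice is the strongest member of the family; the non-trivial direction ⇒ passes through the slab core. -/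
theorem budgetTightness_iff_aspect_two :
    BudgetTightness ↔
      ∃ (k : ℕ) (c : ℝ), 0 < c ∧ ∀ N : ℕ, ∃ n : ℕ, N ≤ n ∧
        c ≤ (bondPercolation (zdGraph 3) (criticalProbI 3)).real
          {ω | ∃ S : Finset (Sym2 (Site 3)), S.card ≤ k ∧
            ¬ ∃ x ∈ box 3 n, ∃ y ∈ innerBoundary (zdGraph 3) (box 3 (2 * n)),
              (ω \ ↑S) ∈ openConnIn (↑(box 3 (2 * n)) : Set (Site 3)) x y} := by
  constructor
  · intro h
    obtain ⟨k, hk⟩ := budgetTightness_iff_tight_two.1 h (1 / 2) (by norm_num)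
    exact ⟨k, 1 / 2, by norm_num, hk⟩
  · rintro ⟨k, c, hc, hio⟩
    exact ⟨k, 2, c, le_rfl, hc, hio⟩

/-- **`stub_aspectTwo` (registered stub of line `Sketch`): the aspect-2 normal form under its registered
name** — `BudgetTightness ⟺` its own `l = 2` slice. -/
theorem stub_aspectTwo :
    Summit.CriticalPhenomena.PercolationContinuityZ3.Theses.PercBudgetLadder.BudgetTightness ↔
      ∃ (k : ℕ) (c : ℝ), 0 < c ∧ ∀ N : ℕ, ∃ n : ℕ, N ≤ n ∧
        c ≤ (bondPercolation (zdGraph 3) (criticalProbI 3)).real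
          {ω | ∃ S : Finset (Sym2 (Site 3)), S.card ≤ k ∧
            ¬ ∃ x ∈ box 3 n, ∃ y ∈ innerBoundary (zdGraph 3) (box 3 (2 * n)),
              (ω \ ↑S) ∈ openConnIn (↑(box 3 (2 * n)) : Set (Site 3)) x y} :=
  budgetTightness_iff_aspect_two

/-- **Cross-route corollary: `PercBudgetLadder.BudgetTightness → PercNonProliferation.NonProliferation`.**
Bounded-budget tightness of critical annuli at ANY aspect `l ≥ 2` (crux r2 of route `PercBudgetLadder`)
implies that the number of annulus-spanning clusters of `B(n) → ∂ⁱⁿB(2n)` is tight infinitely often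
(crux `NonProliferation` of route `PercNonProliferation`, stmt-CriticalPhenomena-4444): reduce to the
`l = 2` slice by `budgetTightness_iff_aspect_two`, then `nonProliferation_of_budgetTightness_two`
(distinct spanning clusters need distinct edges of any destroying set). -/
theorem nonProliferation_of_budgetTightness (hBT : BudgetTightness) :
    Summit.CriticalPhenomena.PercolationContinuityZ3.Theses.PercNonProliferation.NonProliferation :=
  NonProliferation.nonProliferation_of_budgetTightness_two (budgetTightness_iff_aspect_two.1 hBT)

end Summit.CriticalPhenomena.PercolationContinuityZ3.Theorems.BudgetTightness

end
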